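import Mathlib

/-!
# EriceRemainderEnclosureHistoryAutonomyComparisonAgeCompositionStaticChainNormalForm — (E72b) THE NORMAL FORM OF THE STATIC-CHAIN STEP, `ρ ≤ √2∕2 + x·V`
# («YOUNG LOAD × CHAIN LOAD»), the perturbative linear-efficiency regime, and the NEAR∕FAR SPLIT with its octave recursion — the frame in which the
# budget-form static closure of route (N) is to be proved

Cell `pub-balaban`, β-function sub-cell, BINDER row D4 «RemainderConst leaves for Bałaban's split» (`HOME/BINDER-OWNERS.md`; owner lineage `b2b-balaban-beta-an4`;
this file by co-owner #2 lineage `b2b-balaban-beta-d4-p2`, generation 63), β-FLOW TEAM duty (1), FREEZE (0) honoured (def-free, Mathlib only; (E71a)–(E71d) are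
referred to BY NAME, nothing restated).

HONEST FRAMING (page 1, verbatim and binding).  *"Discharging BetaPertH makes Bałaban's UV stability UNCONDITIONAL — a real constructive-QFT result; it is
NOT the continuum limit and NOT the Clay problem."*  THIS FILE DISCHARGES NOTHING OF THE KIND.  Elementary algebra of finite sums and products of real numbers —
hypotheses of a census, not facts; the form, signs, ages and moments of Bałaban's (1.22) limit functional are NOT PRINTED ([I] p. 298; GAPS G-t4-U2-1∕-2) and
NOT asserted.  Row D4 class UNCHANGED (critical-path width 0; instance 0∕1; D4 DISCHARGE NO DATE).  HONEST DEPENDENCY: continuum YM on T⁴ ⇐ BetaPertH ∧ nine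
spine estimates (0/9 proved); BetaPertH ⇐ (D1) ∧ (D4) ∧ CAP+tail; G-an2-4 gates asym, D1 and NE2/3/4.

THE POINT (census sense (α); route (N), READMEs `g62/e71` §PS3–PS4 and `g63/e72`; companion of (E72a) `…AgeCompositionStaticChain`, whose MAJORANT PRINCIPLE
licenses the crude data used here).  A step of the crude budget-form chain has KEY ratio `ρ = x(1+V)∕(1−Ω)` with `x` the young load, `V = Σ_{k older} θ_k β_k`
the CHAIN LOAD, `Ω ≤ √2·W`, `W = Σ_{k older}(S_{k,y}∕k)x_k` the older usage of (E65a)'s budget at the young scale `y`, `s_y x + W ≤ ½`, `s_y ≥ 1∕√2`.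
§4 **THE NORMAL FORM** (`key_ratio_le_of_product_bound`, `key_ratio_lt_one_of_product_lt`, `key_ratio_le_sqrt_two`; general constants `Ω ≤ cW`, `cs ≥ 1`,
`c < 2`): **`ρ ≤ c∕2 + T` whenever the PRODUCT `x·V ≤ T ≤ 1 − c∕2`** (`1 − Ω ≥ (1−c∕2) + x`, `x ≤ c∕2`, monotonicity of `(x+T)∕((1−c∕2)+x)`); for route (N)
`ρ ≤ √2∕2 + x·V` with equality at the lone saturated age — so THE BUDGET-FORM STATIC CLOSURE IS EXACTLY A UNIFORM BOUND `x·V ≤ T⋆ < 1 − √2∕2 = 0.2929` ON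
«YOUNG LOAD × CHAIN LOAD» over the budget polytope (then `q = √2∕2 + T⋆`).  `key_ratio_le_of_linear_efficiency`: the PERTURBATIVE regime `V ≤ κW` closes
for `κ < 16(1−c∕2)∕c = 3.31` with `ρ ≤ 1 − ((1−c∕2) − cκ∕16)` — the adversary's `ρ`-maximiser lives here (young near its lone cap, light far old loads of
efficiency `V∕W ≈ 2.4`: `max_W √2(½−W)(1+2.4W)∕(1−√2W) = 0.88 ≥ 0.78` observed).
§5 **NEAR∕FAR** (`load_split`, **`octave_recursion_bound`**, `hyperbolic_weight_decay`, `hyperbolic_weight_mono`).  With the carried ratios in closed form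
`b_{m,i} = ρ_i·Π_{i≤j<m}(1−ρ_j)⁻¹` ((E72a) `beta_closed_form`), splitting the older ages at an index `p` (far `i < p`, near `p ≤ i < m`):
`load ≤ load_near + E_near·δ·load_far^{(seen from the splitting scale)}` whenever the far defects seen from the young scale are `≤ δ ×` those seen from the
splitting scale — for the hyperbolic weights `2z∕(k+az)` and a scale ratio `R`: `δ(R) = (1+a)∕(R+a)` (`0.6875` per octave at `a = 1.2`); iterating over blocks
`λ_i ≤ ν_i + e_i δ λ_{i+1}` gives **`λ_0 ≤ Σ_i δ^i (Π_{i'<i} e_{i'}) ν_i`** — every block's OWN load, discounted geometrically in the block distance and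
multiplied by the compounding of the NEARER blocks only.  Hence (README §4) the closure `x·V ≤ T⋆` splits into (i) a NEAR-WINDOW LEMMA (bounded scale ratio
`R`, any number of ages: `x_z·ν_near` and `e_near·x_z∕x_z^{(near removed)}`, governed by the OLD scales' budgets, which charge the whole window at weight
`≥ 2∕(1+√(1+R))` while the young's own scale charges far ages only `∝ y∕k`) and (ii) the far recursion with `δ(R)·(x_z∕x^{virt}_{Rz}) ≤ (1+a)√R∕(R+a) → 0`.

NUMERICS OF RECORD (`HOME/b2b-balaban-beta-d4-p2/g63/numerics/`, adversarial over (E65a)'s polytope, all scales, families as in (E72a)): **`sup x·V = 0.12–0.17`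
in EVERY family** (0.117 {1,2}; 0.147 {1..8}; 0.158 {1..16}; 0.168 {8..16}∪{64}; `≤ 0.19` under `θ̄ ≤ 2∕(r+1.2)`) against the threshold 0.2929 — the product is
the scale- and density-ROBUST invariant, while `V` alone reaches 3.9 and `(1+V)∕(1−√2W)` 11.8 (then an OLD scale's budget pins the young load: loads
{5:.12, 6:.21, 7:.22, 8:.08} leave slack 0.008 at scale 7 and force `x_4 ≤ 0.011` though scale 4 keeps slack 0.159; relaxing the young load to its own scale's
budget reaches `ρ = 1.12` — the young-scale budget ALONE CANNOT close the chain); frontier for {1..10}: `sup V ≈ 1.26, 0.68, 0.33, 0.10` at young load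
`x = 0.05, 0.2, 0.4, 0.65`, `sup ρ(x)` increasing to `0.76` at `x ≈ 0.64`.  §6 (appended, same generation): **`closure_of_joint_near_window`** — the far
recursion as an INDUCTION PRINCIPLE over the number of blocks: base `T ≤ A`, split `T ≤ A + δ·B·T(far)`, and the JOINT near-window lemma `A + δ·B·T⋆ ≤ T⋆`
for every configuration give `T ≤ T⋆` everywhere (and `key_ratio_lt_one_of_joint_near_window`); the joint form is what keeps `R` small (measured joint sup
0.21 at R = 16 vs the separated form's need for R ≥ 128, README §4); `key_ratio_le_of_near_window` is the ρ-FORM of the split step, `ρ ≤ (x(1+ν) +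
δ·B·T⋆)∕(1 − cW)` with the young's ACTUAL older usage `W` (measured sup 0.795 at R = 16 — the criterion to certify, margin ≈ 20 %).  NOT CLAIMED: the static closure; the near-window lemma; `θ̄ ≤ 2∕(r+a)` as a theorem;
MONO; (E58′); anything nonlinear; anything printed.
-/
noncomputable section
open Finset

namespace Summit.QuantumFields.BalabanUV.Beta.EriceRemainderEnclosureHistoryAutonomyComparisonAgeCompositionStaticChainNormalForm

/-! ## §4 The normal form: `ρ ≤ c∕2 + x·V` -/

/-- `(x + T)∕(d + x)` is non-decreasing in `x ≥ 0` when `T ≤ d`, `d > 0`. [folklore] -/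
theorem add_div_add_le_of_le {x X T d : ℝ} (hx : 0 ≤ x) (hxX : x ≤ X) (hTd : T ≤ d) (hd : 0 < d) :
    (x + T) / (d + x) ≤ (X + T) / (d + X) := by
  rw [div_le_div_iff₀ (by linarith) (by linarith)]
  nlinarith [mul_nonneg (sub_nonneg.mpr hxX) (sub_nonneg.mpr hTd)]

/-- **THE NORMAL FORM OF A STATIC-CHAIN STEP («young load × chain load»).**  Young load `x ≥ 0`, chain load `V ≥ 0`, older usage `W ≥ 0` of the young
scale's budget with `s·x + W ≤ ½`, older window mass `Ω ≤ c·W`, constants with `c·s ≥ 1`, `c < 2`.  If the PRODUCT `x·V ≤ T ≤ 1 − c∕2` then the denominator is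
positive and **`ρ = x(1+V)∕(1−Ω) ≤ c∕2 + T`**.  Proof: `1 − Ω ≥ 1 − c(½ − sx) ≥ (1 − c∕2) + x`, `x(1+V) ≤ x + T`, and `(x+T)∕((1−c∕2)+x)` is non-decreasing in
`x ≤ 1∕(2s) ≤ c∕2`.  For route (N) (`c = √2`, `s = S_{y,y}∕y ≥ 1∕√2`): `ρ ≤ √2∕2 + x·V`, equality at the LONE saturated age (`x = √2∕2`, `V = W = 0`), so a
uniform bound `x·V ≤ T⋆ < 1 − √2∕2 = 0.2929` on the product «young load × chain load» over the budget polytope IS the budget-form static closure (with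
`q = √2∕2 + T⋆`); numerics of record: `sup x·V = 0.12–0.17` over every family tested. [folklore] -/
theorem key_ratio_le_of_product_bound {x V Ω W s c T : ℝ} (hx : 0 ≤ x) (hV : 0 ≤ V) (hW : 0 ≤ W) (hΩ : Ω ≤ c * W)
    (hbudget : s * x + W ≤ 1 / 2) (hs : 0 < s) (hcs : 1 ≤ c * s) (hc2 : c < 2) (hT : x * V ≤ T) (hTc : T ≤ 1 - c / 2) :
    0 < 1 - Ω ∧ x * (1 + V) / (1 - Ω) ≤ c / 2 + T := by
  have hc0 : 0 < c := by nlinarith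
  have hden : (1 - c / 2) + x ≤ 1 - Ω := by nlinarith
  have hd0 : 0 < 1 - c / 2 := by linarith
  have hxmax : x ≤ c / 2 := by nlinarith
  have hpos : 0 < (1 - c / 2) + x := by linarith
  refine ⟨lt_of_lt_of_le hpos hden, ?_⟩
  calc x * (1 + V) / (1 - Ω) ≤ (x + T) / ((1 - c / 2) + x) :=
        div_le_div₀ (by nlinarith) (by nlinarith) hpos hden
    _ ≤ (c / 2 + T) / ((1 - c / 2) + c / 2) := add_div_add_le_of_le hx hxmax hTc hd0
    _ = c / 2 + T := by ring

/-- **CLOSURE CRITERION.**  In the setting of `key_ratio_le_of_product_bound`, `x·V ≤ T < 1 − c∕2` gives `ρ < 1`. [folklore] -/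
theorem key_ratio_lt_one_of_product_lt {x V Ω W s c T : ℝ} (hx : 0 ≤ x) (hV : 0 ≤ V) (hW : 0 ≤ W) (hΩ : Ω ≤ c * W)
    (hbudget : s * x + W ≤ 1 / 2) (hs : 0 < s) (hcs : 1 ≤ c * s) (hc2 : c < 2) (hT : x * V ≤ T) (hTc : T < 1 - c / 2) :
    x * (1 + V) / (1 - Ω) < 1 := by
  have h := key_ratio_le_of_product_bound hx hV hW hΩ hbudget hs hcs hc2 hT hTc.le
  linarith [h.2]

/-- THE CONSTANTS OF ROUTE (N): `Ω ≤ √2·W` and `s·x + W ≤ ½` with `s ≥ 1∕√2` ((E65a)'s window budget at the young scale, `S_{k,y} ≥ y∕√2`); then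
`ρ ≤ √2∕2 + T` whenever `x·V ≤ T ≤ 1 − √2∕2`. [folklore] -/
theorem key_ratio_le_sqrt_two {x V Ω W s T : ℝ} (hx : 0 ≤ x) (hV : 0 ≤ V) (hW : 0 ≤ W) (hΩ : Ω ≤ Real.sqrt 2 * W)
    (hbudget : s * x + W ≤ 1 / 2) (hs : 1 / Real.sqrt 2 ≤ s) (hT : x * V ≤ T) (hTc : T ≤ 1 - Real.sqrt 2 / 2) :
    0 < 1 - Ω ∧ x * (1 + V) / (1 - Ω) ≤ Real.sqrt 2 / 2 + T := by
  have h2 : Real.sqrt 2 * Real.sqrt 2 = 2 := Real.mul_self_sqrt (by norm_num)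
  have hsq0 : 0 < Real.sqrt 2 := Real.sqrt_pos.mpr (by norm_num)
  have hs0 : 0 < s := lt_of_lt_of_le (by positivity) hs
  have hcs : 1 ≤ Real.sqrt 2 * s := by
    have := mul_le_mul_of_nonneg_left hs hsq0.le
    rwa [mul_one_div, div_self hsq0.ne'] at this
  have hc2 : Real.sqrt 2 < 2 := by nlinarith
  exact key_ratio_le_of_product_bound hx hV hW hΩ hbudget hs0 hcs hc2 hT hTc

/-- **THE PERTURBATIVE REGIME (linear efficiency).**  If at a step the chain load is dominated LINEARLY by the old usage of the young scale's budget,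
`V ≤ κ·W`, then with the budget `s·x + W ≤ ½`, `Ω ≤ c·W`, `c·s ≥ 1`, `c < 2`: the KEY ratio obeys `ρ ≤ c(½−W)(1+κW)∕(1−cW) = 1 − [(1−c∕2) − cκ·W(½−W)]∕(1−cW)`,
hence **`ρ ≤ 1 − ((1 − c∕2) − cκ∕16)`** as soon as `cκ∕16 ≤ 1 − c∕2` — for `c = √2`: closure of the step for every efficiency
`κ < 16(1−√2∕2)∕√2 = 3.31`.  This is the EXTREMAL MECHANISM of the crude budget-form chain found by the adversary (README §2: the `ρ`-maximiser is a
young age near its lone cap plus LIGHT FAR old loads of efficiency `V∕W ≈ 2.4`, giving `max_W √2(½−W)(1+2.4W)∕(1−√2W) ≈ 0.88 ≥` the observed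
`0.76–0.78`); it is NOT a closure proof (the efficiency `V∕W` is unbounded over the polytope — up to `5.8` where old scales, not the young one, bind the
young load). [folklore] -/
theorem key_ratio_le_of_linear_efficiency {x V Ω W s c κ : ℝ} (hx : 0 ≤ x) (hW : 0 ≤ W) (hΩ : Ω ≤ c * W)
    (hbudget : s * x + W ≤ 1 / 2) (hs : 0 < s) (hcs : 1 ≤ c * s) (hc2 : c < 2) (hκ : 0 ≤ κ) (hVW : V ≤ κ * W)
    (hη : c * κ / 16 ≤ 1 - c / 2) :
    0 < 1 - Ω ∧ x * (1 + V) / (1 - Ω) ≤ 1 - ((1 - c / 2) - c * κ / 16) := by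
  have hc0 : 0 < c := by nlinarith
  have hW2 : W ≤ 1 / 2 := by nlinarith
  have hcW : 0 < 1 - c * W := by nlinarith
  have hden : 1 - c * W ≤ 1 - Ω := by linarith
  have hxle : x ≤ c * (1 / 2 - W) := by nlinarith
  have hnum : x * (1 + V) ≤ c * (1 / 2 - W) * (1 + κ * W) := by
    have h1 : x * (1 + V) ≤ x * (1 + κ * W) := mul_le_mul_of_nonneg_left (by linarith) hx
    have h2 : x * (1 + κ * W) ≤ c * (1 / 2 - W) * (1 + κ * W) := mul_le_mul_of_nonneg_right hxle (by positivity)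
    linarith
  have hnum0 : 0 ≤ c * (1 / 2 - W) * (1 + κ * W) := by
    have : 0 ≤ 1 / 2 - W := by linarith
    positivity
  refine ⟨lt_of_lt_of_le hcW hden, ?_⟩
  calc x * (1 + V) / (1 - Ω) ≤ c * (1 / 2 - W) * (1 + κ * W) / (1 - c * W) := div_le_div₀ hnum0 hnum hcW hden
    _ ≤ 1 - ((1 - c / 2) - c * κ / 16) := by
        rw [div_le_iff₀ hcW]
        nlinarith [sq_nonneg (W - 1 / 4), mul_nonneg hc0.le hκ, mul_nonneg (mul_nonneg hc0.le hκ) (sq_nonneg (W - 1 / 4)),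
          mul_nonneg (sub_nonneg.mpr hη) (mul_nonneg hc0.le hW)]

/-! ## §5 Near∕far splitting and the octave recursion -/

/-- **NEAR∕FAR SPLIT OF THE CHAIN LOAD.**  Split the older ages at an index `p ≤ m`: FAR `i < p` (processed first = oldest), NEAR `p ≤ i < m`.  If the far
defects seen from the young scale are at most `δ ×` the defects `θ'` seen from the splitting scale (`θ_i ≤ δ·θ'_i`, `i < p`; for the hyperbolic weights and a
scale ratio `R` between the two scales, `δ = (1+a)∕(R+a)` by `hyperbolic_weight_decay`), then
`Σ_{i<m} θ_i b_{m,i} ≤ Σ_{p≤i<m} θ_i b_{m,i} + E_near·δ·Σ_{i<p} θ'_i b_{p,i}`, `E_near = Π_{p≤j<m}(1−ρ_j)⁻¹`: the NEAR load (near ages with their own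
compounding only) plus the near compounding times the discounted load THE SPLITTING SCALE SEES from the far ages alone (exact factorisation
`E_i = E^{(p)}_i·E_near` for `i < p`). [folklore] -/
theorem load_split {ρ θ θ' : ℕ → ℝ} {p m : ℕ} (hpm : p ≤ m) (hρ0 : ∀ j, j < m → 0 ≤ ρ j) (hρ1 : ∀ j, j < m → ρ j < 1)
    {δ : ℝ} (hfar : ∀ i, i < p → θ i ≤ δ * θ' i) :
    ∑ i ∈ range m, θ i * (ρ i * ∏ j ∈ Ico i m, (1 - ρ j)⁻¹) ≤
      ∑ i ∈ Ico p m, θ i * (ρ i * ∏ j ∈ Ico i m, (1 - ρ j)⁻¹) +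
      (∏ j ∈ Ico p m, (1 - ρ j)⁻¹) * (δ * ∑ i ∈ range p, θ' i * (ρ i * ∏ j ∈ Ico i p, (1 - ρ j)⁻¹)) := by
  have hE0 : 0 ≤ ∏ j ∈ Ico p m, (1 - ρ j)⁻¹ :=
    prod_nonneg fun j hj => (inv_pos.mpr (sub_pos.mpr (hρ1 j (mem_Ico.mp hj).2))).le
  rw [← Nat.Ico_zero_eq_range, ← sum_Ico_consecutive _ (Nat.zero_le p) hpm, Nat.Ico_zero_eq_range]
  suffices hfarsum : ∑ i ∈ range p, θ i * (ρ i * ∏ j ∈ Ico i m, (1 - ρ j)⁻¹) ≤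
      (∏ j ∈ Ico p m, (1 - ρ j)⁻¹) * (δ * ∑ i ∈ range p, θ' i * (ρ i * ∏ j ∈ Ico i p, (1 - ρ j)⁻¹)) by linarith
  rw [mul_comm, mul_sum, sum_mul]
  refine sum_le_sum fun i hi => ?_
  have hip : i < p := mem_range.mp hi
  have hEi : ∏ j ∈ Ico i m, (1 - ρ j)⁻¹ = (∏ j ∈ Ico i p, (1 - ρ j)⁻¹) * ∏ j ∈ Ico p m, (1 - ρ j)⁻¹ :=
    (prod_Ico_consecutive _ hip.le hpm).symm
  have hEp0 : 0 ≤ ∏ j ∈ Ico i p, (1 - ρ j)⁻¹ :=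
    prod_nonneg fun j hj => (inv_pos.mpr (sub_pos.mpr (hρ1 j (lt_of_lt_of_le (mem_Ico.mp hj).2 hpm)))).le
  have hw : 0 ≤ ρ i * (∏ j ∈ Ico i p, (1 - ρ j)⁻¹) * ∏ j ∈ Ico p m, (1 - ρ j)⁻¹ :=
    mul_nonneg (mul_nonneg (hρ0 i (lt_of_lt_of_le hip hpm)) hEp0) hE0
  rw [hEi]
  nlinarith [mul_le_mul_of_nonneg_right (hfar i hip) hw]

/-- **THE OCTAVE (BLOCK) RECURSION.**  If block loads satisfy `λ_i ≤ ν_i + e_i·δ·λ_{i+1}` for `i < D` (`ν_i` = the block's own load seen from its base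
scale, `e_i ≥ 0` its compounding, `δ ≥ 0` the per-block discount of `load_split`) and nothing lies beyond the last block (`λ_D ≤ 0`), then
`λ_0 ≤ Σ_{i<D} δ^i·(Π_{i'<i} e_{i'})·ν_i`: the young age sees each block's own load discounted geometrically in the block distance and multiplied by the
compounding of the blocks NEARER than it (never by the farther ones).  Convergence of the budget-form closure argument = «per-block compounding `e_i` below
`1∕δ` on average» (for octaves and `a = 1.2`: `1∕δ = 1.45`, i.e. `Σ_{block} log(1−ρ)⁻¹ < 0.375` sustained), which (E65a)'s budgets enforce in the mean
(sustained octave loads `≤ 0.073–0.115`) but not blockwise (a saturated dense octave has `e ≈ 4`) — README §4. [folklore] -/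
theorem octave_recursion_bound {δ : ℝ} (hδ : 0 ≤ δ) :
    ∀ (D : ℕ) (lam nu e : ℕ → ℝ), (∀ i, i < D → 0 ≤ e i) → (∀ i, i < D → lam i ≤ nu i + e i * δ * lam (i + 1)) →
      lam D ≤ 0 → lam 0 ≤ ∑ i ∈ range D, δ ^ i * (∏ i' ∈ range i, e i') * nu i := by
  intro D
  induction D with
  | zero => intro lam nu e _ _ hD; simpa using hD
  | succ D ih =>
    intro lam nu e he hrec hD
    have h1 : lam 1 ≤ ∑ i ∈ range D, δ ^ i * (∏ i' ∈ range i, e (i' + 1)) * nu (i + 1) :=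
      ih (fun i => lam (i + 1)) (fun i => nu (i + 1)) (fun i => e (i + 1)) (fun i hi => he (i + 1) (by omega))
        (fun i hi => hrec (i + 1) (by omega)) hD
    have h0 : lam 0 ≤ nu 0 + e 0 * δ * lam 1 := hrec 0 (by omega)
    have hed : 0 ≤ e 0 * δ := mul_nonneg (he 0 (by omega)) hδ
    calc lam 0 ≤ nu 0 + e 0 * δ * lam 1 := h0
      _ ≤ nu 0 + e 0 * δ * ∑ i ∈ range D, δ ^ i * (∏ i' ∈ range i, e (i' + 1)) * nu (i + 1) := by
          nlinarith [mul_le_mul_of_nonneg_left h1 hed]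
      _ = ∑ i ∈ range (D + 1), δ ^ i * (∏ i' ∈ range i, e i') * nu i := by
          rw [sum_range_succ', mul_sum]
          simp only [pow_zero, range_zero, prod_empty, one_mul, mul_one, prod_range_succ', pow_succ]
          rw [add_comm]
          congr 1
          exact sum_congr rfl fun i _ => by ring

/-- **FAR DECAY OF THE HYPERBOLIC WEIGHTS.**  The hyperbolic majorant of the persistence defect of an age `k` seen from the scale `z` is `2z∕(k + az)`
(`= 2∕(r+a)`, `r = k∕z`); seen from `z` rather than from `Rz` (`R ≥ 1`), an age beyond `Rz` loses at least the factor `δ(R) = (1+a)∕(R+a)`: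
`2z∕(k+az) ≤ δ(R)·2Rz∕(k+aRz)` for `k ≥ Rz` (`a = 1.2`: `δ(2) = 0.6875`, `δ(4) = 0.42`, `δ(16) = 0.128`; `a = 0` gives the pure moment `1∕R`). [folklore] -/
theorem hyperbolic_weight_decay {z k R a : ℝ} (hz : 0 < z) (hR : 1 ≤ R) (ha : 0 ≤ a) (hk : R * z ≤ k) :
    2 * z / (k + a * z) ≤ (1 + a) / (R + a) * (2 * (R * z) / (k + a * (R * z))) := by
  have hk0 : 0 < k := lt_of_lt_of_le (by nlinarith) hk
  have h1 : 0 < k + a * z := by positivity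
  have h2 : 0 < k + a * (R * z) := by positivity
  have h3 : 0 < R + a := by linarith
  rw [div_mul_div_comm, div_le_div_iff₀ h1 (mul_pos h3 h2)]
  nlinarith [mul_nonneg hz.le (mul_nonneg (mul_nonneg ha (sub_nonneg.mpr hR)) (sub_nonneg.mpr hk))]

/-- The hyperbolic weight `2z∕(k+az)` of a fixed older age `k` is non-decreasing in the target scale `z`: before compounding, the load the OLD ages present
to a younger scale is at most the load they present to an older one. [folklore] -/
theorem hyperbolic_weight_mono {z z' k a : ℝ} (hz : 0 < z) (hzz' : z ≤ z') (hk : 0 < k) (ha : 0 ≤ a) :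
    2 * z / (k + a * z) ≤ 2 * z' / (k + a * z') := by
  have hz' : 0 < z' := lt_of_lt_of_le hz hzz'
  have h1 : 0 < k + a * z := by positivity
  have h2 : 0 < k + a * z' := by positivity
  rw [div_le_div_iff₀ h1 h2]
  nlinarith [mul_le_mul_of_nonneg_left hzz' hk.le, mul_nonneg ha (mul_nonneg hz.le hz'.le)]

/-! ## §6 The far recursion as an induction principle (joint near-window form) -/

/-- **BUDGET-FORM CLOSURE FROM A JOINT NEAR-WINDOW LEMMA (the far recursion of README `g63/e72` §4, joint form).**  Abstract configurations `c : C`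
with a LEVEL `lvl c` (number of `R`-blocks above the young), a FAR map (`far c` = the virtual young at `Rz` with the ages beyond `Rz`, one level down), the
product `T c` («young load × chain load»), the NEAR term `A c = x_z·ν_near` and the transfer factor `B c = x_z·e_near∕x^{virt}_{Rz} ≥ 0`.  If
(i) at level `0` (no old ages beyond the near window) `T c ≤ A c`, (ii) the SPLIT inequality `T c ≤ A c + δ·B c·T (far c)` holds at positive level (this is
`load_split` with `θ̄`'s far decay, multiplied by `x_z`), and (iii) the JOINT NEAR-WINDOW LEMMA `A c + δ·B c·T⋆ ≤ T⋆` holds for EVERY configuration, then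
`T c ≤ T⋆` for every configuration (strong induction on the level).  With (E72b) `key_ratio_le_sqrt_two` this is the budget-form static closure
`ρ ≤ √2∕2 + T⋆ < 1` as soon as `T⋆ < 1 − √2∕2`.  Numerics of record (`g63/numerics/t34j.py`, job j302760): the supremum of `A + δ_θ̄(R)·B·T⋆` over
(E65a)'s polytope is `0.24` (R = 8), `0.21` (R = 16), `≤ 0.19` (R = 32) at `T⋆ = 0.25` and small young ages — the two worst cases of `A` and `B` exclude each
other — against the separated requirement `A_R∕(1 − δ_θ̄(R)·√R)`, which needs `R ≥ 128`. [folklore] -/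
theorem closure_of_joint_near_window {C : Type*} (lvl : C → ℕ) (far : C → C) (T A B : C → ℝ) {δ Tstar : ℝ}
    (hδ : 0 ≤ δ) (hTstar : 0 ≤ Tstar) (hB : ∀ c, 0 ≤ B c) (hlvl : ∀ c, 0 < lvl c → lvl (far c) < lvl c)
    (hbase : ∀ c, lvl c = 0 → T c ≤ A c) (hsplit : ∀ c, 0 < lvl c → T c ≤ A c + δ * B c * T (far c))
    (hjoint : ∀ c, A c + δ * B c * Tstar ≤ Tstar) : ∀ c, T c ≤ Tstar := by
  suffices h : ∀ n : ℕ, ∀ c, lvl c ≤ n → T c ≤ Tstar from fun c => h (lvl c) c le_rfl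
  have hzero : ∀ c, lvl c = 0 → T c ≤ Tstar := fun c h0 => by
    have h1 := hbase c h0
    have h2 := hjoint c
    have h3 : 0 ≤ δ * B c * Tstar := mul_nonneg (mul_nonneg hδ (hB c)) hTstar
    linarith
  intro n
  induction n with
  | zero => exact fun c hc => hzero c (Nat.le_zero.mp hc)
  | succ n ih =>
    intro c hc
    by_cases h0 : lvl c = 0
    · exact hzero c h0
    · have hpos : 0 < lvl c := Nat.pos_of_ne_zero h0
      have hfar : T (far c) ≤ Tstar := ih (far c) (by have := hlvl c hpos; omega)
      calc T c ≤ A c + δ * B c * T (far c) := hsplit c hpos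
        _ ≤ A c + δ * B c * Tstar := by nlinarith [mul_le_mul_of_nonneg_left hfar (mul_nonneg hδ (hB c))]
        _ ≤ Tstar := hjoint c

/-- **COROLLARY: THE STEP CLOSES.**  In the setting of `closure_of_joint_near_window` with `T⋆ < 1 − c∕2`, a step whose normal-form data `(x, V, Ω, W, s)`
(as in `key_ratio_le_of_product_bound`) has product `x·V ≤ T c₀` for some configuration `c₀` has KEY ratio `x(1+V)∕(1−Ω) ≤ c∕2 + T⋆ < 1`. [folklore] -/
theorem key_ratio_lt_one_of_joint_near_window {C : Type*} (lvl : C → ℕ) (far : C → C) (T A B : C → ℝ) {δ Tstar : ℝ}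
    (hδ : 0 ≤ δ) (hTstar : 0 ≤ Tstar) (hB : ∀ c, 0 ≤ B c) (hlvl : ∀ c, 0 < lvl c → lvl (far c) < lvl c)
    (hbase : ∀ c, lvl c = 0 → T c ≤ A c) (hsplit : ∀ c, 0 < lvl c → T c ≤ A c + δ * B c * T (far c))
    (hjoint : ∀ c, A c + δ * B c * Tstar ≤ Tstar)
    {x V Ω W s cc : ℝ} (hx : 0 ≤ x) (hV : 0 ≤ V) (hW : 0 ≤ W) (hΩ : Ω ≤ cc * W) (hbudget : s * x + W ≤ 1 / 2) (hs : 0 < s)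
    (hcs : 1 ≤ cc * s) (hc2 : cc < 2) {c₀ : C} (hprod : x * V ≤ T c₀) (hTc : Tstar < 1 - cc / 2) :
    x * (1 + V) / (1 - Ω) < 1 :=
  key_ratio_lt_one_of_product_lt hx hV hW hΩ hbudget hs hcs hc2
    (hprod.trans (closure_of_joint_near_window lvl far T A B hδ hTstar hB hlvl hbase hsplit hjoint c₀)) hTc

/-- **THE ρ-FORM OF THE STEP AFTER THE SPLIT (keeps the young's actual older usage `W`).**  If the chain load splits as `x·V ≤ x·ν + δ·B·T_far` (near load `ν`,
transfer factor `B ≥ 0`, far product `T_far ≤ T⋆` — `load_split` times `x`, with `closure_of_joint_near_window` bounding the far product) and `Ω ≤ c·W`,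
`c·W < 1`, then **`ρ = x(1+V)∕(1−Ω) ≤ (x(1+ν) + δ·B·T⋆)∕(1 − c·W)`**.  This is the criterion to certify configuration by configuration («ρ-form joint
near-window lemma»): it does NOT replace `1 − √2W` by its worst case `1 − √2(½ − s x)` as the normal form does, and so keeps the slack of the configurations
where an OLD scale, not the young one, pins the young load (there `W < ½ − s x`).  Numerics of record (`g63/numerics/t34j.py`, T⋆ = 0.3): sup of the right side
over (E65a)'s polytope `0.795` (R = 16; true ρ there 0.72), `0.809` (R = 8) — margin ≈ 20 % to 1, against ≈ 8 % for `√2∕2 + T⋆`; job j302670: at larger young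
ages the far «comb» raises `sup x·V` to ≈ 0.22 (Z = 48) while ρ there stays ≈ 0.72. [folklore] -/
theorem key_ratio_le_of_near_window {x V Ω W c ν δ B Tfar Tstar : ℝ} (hx : 0 ≤ x) (hν : 0 ≤ ν) (hΩ : Ω ≤ c * W) (hcW : c * W < 1)
    (hδ : 0 ≤ δ) (hB : 0 ≤ B) (hTstar : 0 ≤ Tstar) (hsplit : x * V ≤ x * ν + δ * B * Tfar) (hfar : Tfar ≤ Tstar) :
    x * (1 + V) / (1 - Ω) ≤ (x * (1 + ν) + δ * B * Tstar) / (1 - c * W) := by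
  have hden : 0 < 1 - c * W := by linarith
  have hden' : 1 - c * W ≤ 1 - Ω := by linarith
  have hnum : x * (1 + V) ≤ x * (1 + ν) + δ * B * Tstar := by
    nlinarith [mul_le_mul_of_nonneg_left hfar (mul_nonneg hδ hB)]
  have hnum0 : 0 ≤ x * (1 + ν) + δ * B * Tstar := by positivity
  exact div_le_div₀ hnum0 hnum hden hden'

end Summit.QuantumFields.BalabanUV.Beta.EriceRemainderEnclosureHistoryAutonomyComparisonAgeCompositionStaticChainNormalForm

end
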